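import Literature.AlgebraicGeometry.Resolution.KollarOrderReduction
import Literature.AlgebraicGeometry.Resolution.BlowupsComposition
import HarnessLib

/-!
# `FibrewiseClosedPoints` — support lemmas: a Cossart–Piltant principalization sequence is one
blowing up with centre supported in the non-principal locus

Helper lemma for crux `stmt-ResolutionOfSingularities-15960` (re-centering / trace-ideal-untwist
mechanism, `Cruxes/FibrewiseClosedPoints/ExactCentre.md` §5 item 5 (ii), bridge lemma "a
regular-centre sequence is ONE blowing up with support in the union of the images of its
centres"), lead c2, 2026-08-17: the output `σ : S' → S` of the named fact
`CossartPiltant2019Principalization` (`IsRegularCentreBlowupSeq σ M`: blowing ups along regular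
integral centres lying in the non-locally-principal loci of the transforms of `M`) is a single
blowing up of the Noetherian base `S` along an ideal sheaf `𝔟` whose support consists of points
where `M` is NOT locally principal (Stacks 080B stage by stage; the pull-back of a locally
principal ideal is locally principal). This is the shape consumed by
`TraceIdeal.exists_oneShot_of_isBlowup` (`…TraceIdealAssembly.lean`): with `M = ((a):J)~·𝒪_{Bl_J}`,
whose non-principal locus lies over `Sing(Spec A)`, the support of `𝔟` lies over `Sing`.

* `IsRegularCentreBlowupSeq.exists_isBlowup_support_subset` — the lemma.

## Sources
* The Stacks Project, Tag 080B. [StacksProject]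
* V. Cossart, O. Piltant, J. Algebra 529 (2019), Prop. 4.4 (arXiv v1: Prop. 4.3). [CossartPiltant2019]
-/

noncomputable section

set_option linter.dupNamespace false

open AlgebraicGeometry CategoryTheory Literature.AlgebraicGeometry.Resolution

namespace Summit.ResolutionOfSingularities.ResolutionOfSingularities.Theorems.SectionAscent.TraceIdeal

universe u

/-- **A Cossart–Piltant sequence of blowing ups along regular centres is a single blowing up
whose centre is supported in the non-locally-principal locus of the ideal being principalized**
(`S` Noetherian): by induction on the sequence, composing with Stacks 080B
(`IsBlowup.exists_isBlowup_comp`: the support of the composite centre is contained in the support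
of the first centre union the image of the support of the second), and using that each centre
`Y ⊆ S'` consists of points where `M𝒪_{S'}` is not locally principal, whose images are points
where `M` is not locally principal (`IsLocallyPrincipalAt.comap`).
[cite: StacksProject, Tag 080B] -/
theorem IsRegularCentreBlowupSeq.exists_isBlowup_support_subset {S' S : Scheme.{u}}
    {σ : S' ⟶ S} {M : S.IdealSheafData} (h : IsRegularCentreBlowupSeq σ M) [IsNoetherian S] :
    ∃ 𝔟 : S.IdealSheafData, IsBlowup σ 𝔟 ∧
      (𝔟.support : Set S) ⊆ {x | ¬ IsLocallyPrincipalAt M x} := by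
  suffices main : ∀ {S' S : Scheme.{u}} {σ : S' ⟶ S} {M : S.IdealSheafData},
      IsRegularCentreBlowupSeq σ M → IsNoetherian S →
        ∃ 𝔟 : S.IdealSheafData, IsBlowup σ 𝔟 ∧
          (𝔟.support : Set S) ⊆ {x | ¬ IsLocallyPrincipalAt M x} from main h inferInstance
  intro S' S σ M h
  induction h with
  | nil M =>
    intro _
    refine ⟨⊤, isBlowup_id_top _, ?_⟩
    rw [Scheme.IdealSheafData.support_top]
    exact fun x hx => hx.elim
  | @cons S'' S' S τ σ M Y hσ _ _ hY hτ ih =>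
    intro hN
    haveI := hN
    obtain ⟨𝔟, h𝔟, hsupp⟩ := ih hN
    obtain ⟨Q, hQ, hQsupp⟩ := h𝔟.exists_isBlowup_comp hτ
    refine ⟨Q, hQ, hQsupp.trans (Set.union_subset hsupp ?_)⟩
    rintro _ ⟨y, hy, rfl⟩
    rw [Scheme.IdealSheafData.coe_support_vanishingIdeal] at hy
    exact fun hx => hY y hy (hx.comap σ)

/-- Registered helper form of `IsRegularCentreBlowupSeq.exists_isBlowup_support_subset` (universe
`0`, explicit binders). [cite: StacksProject, Tag 080B] -/
theorem exists_isBlowup_support_subset_of_seq (S' S : AlgebraicGeometry.Scheme.{0}) (σ : S' ⟶ S)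
    (M : S.IdealSheafData) (h : Literature.AlgebraicGeometry.Resolution.IsRegularCentreBlowupSeq σ M)
    [AlgebraicGeometry.IsNoetherian S] :
    ∃ 𝔟 : S.IdealSheafData, Literature.AlgebraicGeometry.Resolution.IsBlowup σ 𝔟 ∧
      (𝔟.support : Set S) ⊆ {x | ¬ Literature.AlgebraicGeometry.Resolution.IsLocallyPrincipalAt M x} :=
  IsRegularCentreBlowupSeq.exists_isBlowup_support_subset h

end Summit.ResolutionOfSingularities.ResolutionOfSingularities.Theorems.SectionAscent.TraceIdeal

end
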